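import Literature.NumberTheory.EllipticCurves.FormalInvariantDerivation
import Literature.NumberTheory.EllipticCurves.FormalGroupNegProofs
import HarnessLib

/-!
# The formal inverse against `x`, `y` and the invariant differential:
# `x(i(z)) = x(z)`, `y(i(z)) = -y - a₁x - a₃`, `[-1]^*ω = -ω`, `(Dσ) ∘ i = Dσ` for odd `σ` (proofs only)

Trunk T-NT-EC (Literature/NumberTheory/EllipticCurves). Proof file on the way to the formal
Mazur–Tate theta relation (named fact `WeierstrassCurve.padicSigma_theta_formal`,
`CanonicalPAdicHeightThetaProofs.lean`; Blakestad–Grant 2023, Prop. 14), complementing the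
`x`-calculus of the sibling `FormalGroupXDerivativeProofs.lean` (`Dx = 2y + a₁x + a₃`, the
Weierstrass equation in `X = z²x`) with what Blakestad–Grant's proof needs about the INVERSE
`[-1]`: the theta relation involves `u -_F v = F(u, i(v))`, the right side `x(v) - x(u)` is even,
and the constant of integration is killed by parity ("the first logarithmic derivatives of both
sides are odd in `t₁`", proof of Prop. 14), i.e. by `[-1]^*ω = -ω` and the evenness of `Dσ` for an
odd `σ`. Everything is an identity in `R⟦z⟧` over an ARBITRARY commutative ring, for the tree's
`X = z²x(z) = formalXMulSq`, `w = formalW`, `i = formalNeg = -z/E` (`E = 1 - a₁z - a₃w`),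
`η = formalEta` (`ω = dz/η`) and `D = η d/dz = formalInvariantDerivation`:

* `formalXMulSq_mul_formalW` — `X · w = z³` (`x = z/w`); `formalXMulSq_fixedPoint` — the fixed
  point `w = f(z, w)` (AEC IV.1.1) read through `X`: `X = X² + a₁zX + a₂z²X + a₃z³ + a₄z⁴ + a₆z³w`;
  `formalEta_mul_derivative_formalW` — `η w' = f_z(z, w)`; `coeff_one_formalXMulSq` —
  `X = 1 - a₁z + ⋯`;
* `formalNeg_mul_formalNegDenom`, `formalW_subst_formalNeg_mul_formalNegDenom` — `i·E = -z`,
  `w(i)·E = -w` (AEC IV.1 p. 118, from `FormalGroupNegProofs.lean`);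
* `formalXMulSq_subst_formalNeg` — **`X(i(z)) = X(z)·E⁻²`**, equivalently
  `X(i(z))·z² = X(z)·i(z)²` (`formalXMulSq_subst_formalNeg_mul_X_sq`): **`x(i(z)) = x(z)`**, the
  `x`-coordinate of `-P` (AEC III.2.3); and `formalXMulSq_mul_formalNeg_add` —
  `X·(i + z - a₁zi) = a₃z³i`, which is `y(i(z)) = -y(z) - a₁x(z) - a₃` with poles cleared;
* `formalEta_mul_derivative_formalNeg` — **`η(z)·i'(z) = -η(i(z))`**, i.e. **`[-1]^*ω = -ω`** for
  `ω = dz/η = dx/(2y + a₁x + a₃)` (AEC III.5; under `P ↦ -P`, `x ↦ x` and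
  `2y + a₁x + a₃ ↦ -(2y + a₁x + a₃)`): a polynomial identity in `z, w, i, w(i)` modulo the fixed
  point, its derivative, `i·E = -z`, `w(i)·E = -w`, closed by `linear_combination` with explicit
  machine-found cofactors and the unit `E⁵` cancelled;
* `formalInvariantDerivation_subst_formalNeg` — hence **`D(h ∘ i) = -(Dh) ∘ i`** for every `h`,
  and `formalInvariantDerivation_subst_formalNeg_of_odd` — **`(Dσ) ∘ i = Dσ` for `σ` odd**
  (`IsFormallyOdd`: `σ ∘ i = -σ`).

## Sources

* C. Blakestad, D. Grant, *On the universal `p`-adic sigma and Weierstrass zeta functions*,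
  J. Number Theory 249 (2023) (arXiv:1903.02480), §3 (Prop. 14 and its proof: `t₁ -_𝓕 t₂`,
  "odd in `t₁`").
* J. H. Silverman, *The Arithmetic of Elliptic Curves*, 2nd ed. (2009): III.1 (`ω = dx/(2y + a₁x
  + a₃)`), III.2.3 (`-(x, y) = (x, -y - a₁x - a₃)`), III.5 (invariant differential), IV.1
  (pp. 115–118: `w(z)`, `x = z/w`, `y = -1/w`, `i(z) = x/(y + a₁x + a₃)|_{z}`).

## Design notes

Pure proof file (no definitions, no named facts); independent of `FormalGroupXDerivativeProofs`.
Divisions by `z` are `PowerSeries.X_pow_mul_cancel`, divisions by `E` use that `E` is a unit.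
-/

noncomputable section

open PowerSeries Literature.NumberTheory.EllipticCurves

namespace WeierstrassCurve

variable {R : Type*} [CommRing R] (W : WeierstrassCurve R)

/-! ### `X·w = z³` and the Weierstrass equation in the `z`-chart -/

/-- **`X · w = z³`** (`x = z/w`, `X = z²x`). [Silverman AEC IV.1 (`x = z/w`)] [folklore] -/
theorem formalXMulSq_mul_formalW : W.formalXMulSq * W.formalW = X ^ 3 := by
  rw [W.formalW_eq_X_pow_mul_formalWDivCube, mul_left_comm, mul_comm W.formalXMulSq,
    W.formalWDivCube_mul_formalXMulSq, mul_one]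

/-- `E · E⁻¹ = 1` for `E = 1 - a₁z - a₃w` read through `X·w = z³`:
`X · E = X - a₁zX - a₃z³`. [folklore] -/
theorem formalXMulSq_mul_formalNegDenom :
    W.formalXMulSq * (1 - C W.a₁ * X - C W.a₃ * W.formalW) =
      W.formalXMulSq - C W.a₁ * X * W.formalXMulSq - C W.a₃ * X ^ 3 := by
  linear_combination (-C W.a₃) * W.formalXMulSq_mul_formalW

/-- **The Weierstrass equation in the `z`-chart**:
`X = X² + a₁zX + a₂z²X + a₃z³ + a₄z⁴ + a₆z³w` — the fixed point `w = f(z, w)` (AEC IV.1.1(a))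
multiplied by `X²` and divided by `z³` (`Xw = z³`). Dividing by `z⁶/X` this is
`y² + a₁xy + a₃y = x³ + a₂x² + a₄x + a₆` with `x = X/z²`, `y = -X/z³`.
[Silverman AEC IV.1.1(a), III.1] [cite: SilvermanAEC2009, IV.1.1] -/
theorem formalXMulSq_fixedPoint :
    W.formalXMulSq = W.formalXMulSq ^ 2 + C W.a₁ * X * W.formalXMulSq +
      C W.a₂ * X ^ 2 * W.formalXMulSq + C W.a₃ * X ^ 3 + C W.a₄ * X ^ 4 +
        C W.a₆ * X ^ 3 * W.formalW := by
  have hfp := W.formalWStep_formalW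
  unfold formalWStep at hfp
  have hXw := W.formalXMulSq_mul_formalW
  -- multiply the fixed point by `X²`: both sides become multiples of `z³`
  have h3 : X ^ 3 * W.formalXMulSq = X ^ 3 * (W.formalXMulSq ^ 2 + C W.a₁ * X * W.formalXMulSq +
      C W.a₂ * X ^ 2 * W.formalXMulSq + C W.a₃ * X ^ 3 + C W.a₄ * X ^ 4 +
        C W.a₆ * X ^ 3 * W.formalW) := by
    linear_combination (-(W.formalXMulSq ^ 2)) * hfp +
      (-W.formalXMulSq + C W.a₁ * X * W.formalXMulSq + C W.a₂ * X ^ 2 * W.formalXMulSq +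
        (C W.a₃ + C W.a₄ * X + C W.a₆ * W.formalW) * (W.formalXMulSq * W.formalW + X ^ 3)) * hXw
  exact PowerSeries.X_pow_mul_cancel h3

/-! ### Implicit differentiation and the linear coefficient of `X` -/

/-- **Implicit differentiation, with `η`**: `η · w' = f_z(z, w) = 3z² + a₁w + 2a₂zw + a₄w²`
(`w' = f_z + f_w w'`, `η = 1 - f_w`). [Silverman AEC IV.1] [folklore] -/
theorem formalEta_mul_derivative_formalW :
    W.formalEta * d⁄dX R W.formalW =
      3 * X ^ 2 + C W.a₁ * W.formalW + 2 * C W.a₂ * X * W.formalW + C W.a₄ * W.formalW ^ 2 := by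
  rw [formalEta_def]
  linear_combination W.derivative_formalW

/-- The linear coefficient of `X = 1 - a₁z - ⋯`. [Silverman AEC IV.1 (`x = z⁻² - a₁z⁻¹ - ⋯`)]
[folklore] -/
theorem coeff_one_formalXMulSq : coeff 1 W.formalXMulSq = -W.a₁ := by
  have h0 : constantCoeff W.formalXMulSq = 1 := W.constantCoeff_formalXMulSq
  have hw0 : constantCoeff W.formalW = 0 := W.constantCoeff_formalW
  have e : W.formalXMulSq = W.formalXMulSq * W.formalXMulSq + X * (C W.a₁ * W.formalXMulSq +
      C W.a₂ * X * W.formalXMulSq + C W.a₃ * X ^ 2 + C W.a₄ * X ^ 3 + C W.a₆ * X ^ 2 * W.formalW) := by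
    linear_combination W.formalXMulSq_fixedPoint
  have h := congrArg (coeff (0 + 1)) e
  rw [map_add, coeff_succ_X_mul, Nat.zero_add, PowerSeries.coeff_one_mul, h0, mul_one,
    coeff_zero_eq_constantCoeff_apply] at h
  simp only [map_add, map_mul, constantCoeff_C, constantCoeff_X, h0, hw0, mul_zero,
    add_zero, mul_one, map_pow, zero_pow (Nat.succ_ne_zero _)] at h
  linear_combination -h

/-! ### Negation: `x(i(z)) = x(z)`, `y(i(z)) = -y - a₁x - a₃` -/

/-- `i · E = -z` (`i = -z·E⁻¹`). [Silverman AEC IV.1 (p. 118)] [folklore] -/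
theorem formalNeg_mul_formalNegDenom :
    W.formalNeg * (1 - C W.a₁ * X - C W.a₃ * W.formalW) = -X := by
  rw [formalNeg_eq]
  linear_combination (-X) * W.formalNegDenom_mul_invOfUnit

/-- `w(i) · E = -w` (`w(i(z)) = -w·E⁻¹`). [Silverman AEC IV.1 (p. 118)] [folklore] -/
theorem formalW_subst_formalNeg_mul_formalNegDenom :
    W.formalW.subst W.formalNeg * (1 - C W.a₁ * X - C W.a₃ * W.formalW) = -W.formalW := by
  rw [W.formalW_subst_formalNeg]
  linear_combination (-W.formalW) * W.formalNegDenom_mul_invOfUnit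

/-- **`X(i(z)) = X(z) · E⁻²`** (`E = 1 - a₁z - a₃w`, `i = -z/E`): since `X(i)w(i) = i³` and
`w(i) = -w/E`, this says `x(i(z)) = X(i)/i² = X/z² = x(z)` — the `x`-coordinate of `-P` is that of
`P`. [Silverman AEC III.2.3 (`-(x, y) = (x, -y - a₁x - a₃)`), IV.1 (p. 118)]
[cite: SilvermanAEC2009, IV.1.1] -/
theorem formalXMulSq_subst_formalNeg :
    W.formalXMulSq.subst W.formalNeg =
      W.formalXMulSq * invOfUnit (1 - C W.a₁ * X - C W.a₃ * W.formalW) 1 ^ 2 := by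
  set E := 1 - C W.a₁ * X - C W.a₃ * W.formalW with hE
  set Ei := invOfUnit E 1 with hEi
  have hEE : E * Ei = 1 := W.formalNegDenom_mul_invOfUnit
  have hs := W.hasSubst_formalNeg
  -- `X(i) · w(i) = i³`
  have h1 : W.formalXMulSq.subst W.formalNeg * W.formalW.subst W.formalNeg = W.formalNeg ^ 3 := by
    rw [← PowerSeries.coe_substAlgHom hs, ← map_mul, W.formalXMulSq_mul_formalW, map_pow,
      PowerSeries.substAlgHom_X]
  have hi : W.formalNeg = -(X * Ei) := W.formalNeg_eq
  have hwi : W.formalW.subst W.formalNeg = -(W.formalW * Ei) := W.formalW_subst_formalNeg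
  rw [hwi] at h1
  -- `X(i) · w · Ei = z³ Ei³`, times `X E`: `X(i) z³ = X z³ Ei²`
  have hXw := W.formalXMulSq_mul_formalW
  have h3 : X ^ 3 * W.formalXMulSq.subst W.formalNeg = X ^ 3 * (W.formalXMulSq * Ei ^ 2) := by
    linear_combination (-(W.formalXMulSq * E)) * h1 +
      (-(W.formalXMulSq * E) * (W.formalNeg ^ 2 - W.formalNeg * X * Ei + X ^ 2 * Ei ^ 2)) * hi +
      (W.formalXMulSq * (X ^ 3 * Ei ^ 2 - W.formalXMulSq.subst W.formalNeg * W.formalW)) * hEE +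
      (-W.formalXMulSq.subst W.formalNeg) * hXw
  exact PowerSeries.X_pow_mul_cancel h3

/-- The same in the symmetric form **`X(i(z)) · z² = X(z) · i(z)²`** (`x(i(z)) = x(z)`).
[Silverman AEC III.2.3, IV.1] [cite: SilvermanAEC2009, IV.1.1] -/
theorem formalXMulSq_subst_formalNeg_mul_X_sq :
    W.formalXMulSq.subst W.formalNeg * X ^ 2 = W.formalXMulSq * W.formalNeg ^ 2 := by
  rw [W.formalXMulSq_subst_formalNeg, formalNeg_eq]
  ring

/-- **`y(i(z)) = -y(z) - a₁x(z) - a₃`, poles cleared: `X · (i + z - a₁zi) = a₃z³i`**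
(`i·E = -z` times `X`, with `Xw = z³`). [Silverman AEC III.2.3, IV.1 (p. 118)]
[cite: SilvermanAEC2009, IV.1.1] -/
theorem formalXMulSq_mul_formalNeg_add :
    W.formalXMulSq * (W.formalNeg + X - C W.a₁ * X * W.formalNeg) = C W.a₃ * X ^ 3 * W.formalNeg := by
  linear_combination W.formalXMulSq * W.formalNeg_mul_formalNegDenom +
    C W.a₃ * W.formalNeg * W.formalXMulSq_mul_formalW

/-! ### `[-1]^* ω = -ω`: `η(z) · i'(z) = -η(i(z))` -/

/-- `η(i(z)) = 1 - f_w(i, w(i))` (substitution is a ring homomorphism; `η` is a polynomial in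
`z` and `w(z)`). [folklore] -/
theorem formalEta_subst_formalNeg :
    W.formalEta.subst W.formalNeg = 1 - (C W.a₁ * W.formalNeg + C W.a₂ * W.formalNeg ^ 2 +
      2 * C W.a₃ * W.formalW.subst W.formalNeg +
        2 * C W.a₄ * W.formalNeg * W.formalW.subst W.formalNeg +
          3 * C W.a₆ * W.formalW.subst W.formalNeg ^ 2) := by
  have hs := W.hasSubst_formalNeg
  have hC : ∀ a : R, (C a).subst W.formalNeg = C a := fun a => PowerSeries.subst_C a
  rw [formalEta_def]
  simp only [← PowerSeries.coe_substAlgHom hs, map_add, map_sub, map_one, map_mul, map_pow,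
    map_ofNat, PowerSeries.substAlgHom_X]
  simp only [PowerSeries.coe_substAlgHom hs, hC]

/-- **`[-1]^* ω = -ω` for the invariant differential, formally: `η(z) · i'(z) = -η(i(z))`**
(`ω = dz/η(z) = dx/(2y + a₁x + a₃)`; under `P ↦ -P`, `x ↦ x` and `2y + a₁x + a₃ ↦ -(2y + a₁x + a₃)`,
AEC III.2.3, so `ω ↦ -ω`). Stated for the tree's `η = formalEta`, `i = formalNeg` over any
commutative ring: a polynomial identity in `z, w, i, w(i)` modulo the fixed point, its derivative,
`i·E = -z` and `w(i)·E = -w` (`E = 1 - a₁z - a₃w`). [Silverman AEC III.2.3, III.5.1 (proof: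
`[-1]^*ω = -ω`… for the invariant differential), IV.1 (p. 118, `i(z)`)]
[cite: SilvermanAEC2009, III.5.1] -/
theorem formalEta_mul_derivative_formalNeg :
    W.formalEta * d⁄dX R W.formalNeg = -W.formalEta.subst W.formalNeg := by
  -- the inputs, before abbreviating
  have hη := W.formalEta_def
  have hηs := W.formalEta_subst_formalNeg
  have hiE := W.formalNeg_mul_formalNegDenom
  have hwiE := W.formalW_subst_formalNeg_mul_formalNegDenom
  have hfp := W.formalWStep_formalW
  unfold formalWStep at hfp
  have hηw := W.formalEta_mul_derivative_formalW
  have hdi : d⁄dX R W.formalNeg * (1 - C W.a₁ * X - C W.a₃ * W.formalW) -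
      W.formalNeg * (C W.a₁ + C W.a₃ * d⁄dX R W.formalW) = -1 := by
    have e := congrArg (d⁄dX R) hiE
    simp only [Derivation.leibniz, map_sub, map_neg, derivative_C, derivative_X, smul_eq_mul,
      Derivation.map_one_eq_zero] at e
    linear_combination e
  have hE : IsUnit (1 - C W.a₁ * X - C W.a₃ * W.formalW) := by
    rw [PowerSeries.isUnit_iff_constantCoeff]
    simp [W.constantCoeff_formalW]
  set A₁ : R⟦X⟧ := C W.a₁ with hA₁
  set A₂ : R⟦X⟧ := C W.a₂ with hA₂
  set A₃ : R⟦X⟧ := C W.a₃ with hA₃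
  set A₄ : R⟦X⟧ := C W.a₄ with hA₄
  set A₆ : R⟦X⟧ := C W.a₆ with hA₆
  set w := W.formalW with hw
  set i := W.formalNeg with hi
  set wi := W.formalW.subst W.formalNeg with hwi
  set η := W.formalEta with hηdef
  set ηs := W.formalEta.subst W.formalNeg with hηsdef
  set di := d⁄dX R W.formalNeg with hdidef
  set dw := d⁄dX R W.formalW with hdwdef
  -- step 1: `(η i' + η(i)) · E = -η + i (a₁η + a₃ f_z) + E η(i)`
  have e1 : (η * di + ηs) * (1 - A₁ * X - A₃ * w) =
      -η + i * (A₁ * η + A₃ * (3 * X ^ 2 + A₁ * w + 2 * A₂ * X * w + A₄ * w ^ 2)) +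
        (1 - A₁ * X - A₃ * w) * ηs := by
    linear_combination η * hdi + (A₃ * i) * hηw
  -- step 2: the right side times `E⁴` vanishes
  have e2 : (-η + i * (A₁ * η + A₃ * (3 * X ^ 2 + A₁ * w + 2 * A₂ * X * w + A₄ * w ^ 2)) +
      (1 - A₁ * X - A₃ * w) * ηs) * (1 - A₁ * X - A₃ * w) ^ 4 = 0 := by
  -- certificate: the identity times `E ^ 4` (machine-found cofactors, checked by `ring`)
    linear_combination ((-1 + A₁ * i) * (1 - A₁ * X - A₃ * w) ^ 4) * hη + ((1 - A₁ * X - A₃ * w) ^ 5) * hηs +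
      (-2 * A₁ ^ 4 * A₃ * X ^ 4 - 2 * A₁ ^ 4 * A₄ * X ^ 4 * i - 3 * A₁ ^ 4 * A₆ * X ^ 4 * wi
        - 8 * A₁ ^ 3 * A₃ ^ 2 * X ^ 3 * w - 8 * A₁ ^ 3 * A₃ * A₄ * X ^ 3 * w * i
        - 12 * A₁ ^ 3 * A₃ * A₆ * X ^ 3 * w * wi + 8 * A₁ ^ 3 * A₃ * X ^ 3
        + 8 * A₁ ^ 3 * A₄ * X ^ 3 * i - 3 * A₁ ^ 3 * A₆ * X ^ 3 * w
        + 12 * A₁ ^ 3 * A₆ * X ^ 3 * wi - 12 * A₁ ^ 2 * A₃ ^ 3 * X ^ 2 * w ^ 2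
        - 12 * A₁ ^ 2 * A₃ ^ 2 * A₄ * X ^ 2 * w ^ 2 * i
        - 18 * A₁ ^ 2 * A₃ ^ 2 * A₆ * X ^ 2 * w ^ 2 * wi + 24 * A₁ ^ 2 * A₃ ^ 2 * X ^ 2 * w
        + 24 * A₁ ^ 2 * A₃ * A₄ * X ^ 2 * w * i - 9 * A₁ ^ 2 * A₃ * A₆ * X ^ 2 * w ^ 2
        + 36 * A₁ ^ 2 * A₃ * A₆ * X ^ 2 * w * wi - 12 * A₁ ^ 2 * A₃ * X ^ 2
        - 12 * A₁ ^ 2 * A₄ * X ^ 2 * i + 9 * A₁ ^ 2 * A₆ * X ^ 2 * w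
        - 18 * A₁ ^ 2 * A₆ * X ^ 2 * wi - 8 * A₁ * A₃ ^ 4 * X * w ^ 3
        - 8 * A₁ * A₃ ^ 3 * A₄ * X * w ^ 3 * i - 12 * A₁ * A₃ ^ 3 * A₆ * X * w ^ 3 * wi
        + 24 * A₁ * A₃ ^ 3 * X * w ^ 2 + 24 * A₁ * A₃ ^ 2 * A₄ * X * w ^ 2 * i
        - 9 * A₁ * A₃ ^ 2 * A₆ * X * w ^ 3 + 36 * A₁ * A₃ ^ 2 * A₆ * X * w ^ 2 * wi
        - 24 * A₁ * A₃ ^ 2 * X * w - 24 * A₁ * A₃ * A₄ * X * w * i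
        + 18 * A₁ * A₃ * A₆ * X * w ^ 2 - 36 * A₁ * A₃ * A₆ * X * w * wi + 8 * A₁ * A₃ * X
        + 8 * A₁ * A₄ * X * i - 9 * A₁ * A₆ * X * w + 12 * A₁ * A₆ * X * wi - 2 * A₃ ^ 5 * w ^ 4
        - 2 * A₃ ^ 4 * A₄ * w ^ 4 * i - 3 * A₃ ^ 4 * A₆ * w ^ 4 * wi + 8 * A₃ ^ 4 * w ^ 3
        + 8 * A₃ ^ 3 * A₄ * w ^ 3 * i - 3 * A₃ ^ 3 * A₆ * w ^ 4 + 12 * A₃ ^ 3 * A₆ * w ^ 3 * wi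
        - 12 * A₃ ^ 3 * w ^ 2 - 12 * A₃ ^ 2 * A₄ * w ^ 2 * i + 9 * A₃ ^ 2 * A₆ * w ^ 3
        - 18 * A₃ ^ 2 * A₆ * w ^ 2 * wi + 8 * A₃ ^ 2 * w + 8 * A₃ * A₄ * w * i
        - 9 * A₃ * A₆ * w ^ 2 + 12 * A₃ * A₆ * w * wi - 2 * A₃ - 2 * A₄ * i + 3 * A₆ * w
        - 3 * A₆ * wi) * hwiE +
      (A₁ ^ 4 * A₂ * X ^ 5 - A₁ ^ 4 * A₂ * X ^ 4 * i + 2 * A₁ ^ 4 * A₄ * X ^ 4 * w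
        + 3 * A₁ ^ 4 * A₆ * X ^ 3 * w ^ 2 + A₁ ^ 3 * A₂ * A₃ * X ^ 4 * w
        - 4 * A₁ ^ 3 * A₂ * A₃ * X ^ 3 * w * i - 4 * A₁ ^ 3 * A₂ * X ^ 4
        + 4 * A₁ ^ 3 * A₂ * X ^ 3 * i + 5 * A₁ ^ 3 * A₃ * A₄ * X ^ 3 * w ^ 2
        + 9 * A₁ ^ 3 * A₃ * A₆ * X ^ 2 * w ^ 3 - 3 * A₁ ^ 3 * A₃ * X ^ 5
        - 8 * A₁ ^ 3 * A₄ * X ^ 3 * w - 9 * A₁ ^ 3 * A₆ * X ^ 2 * w ^ 2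
        - 3 * A₁ ^ 2 * A₂ * A₃ ^ 2 * X ^ 3 * w ^ 2 - 6 * A₁ ^ 2 * A₂ * A₃ ^ 2 * X ^ 2 * w ^ 2 * i
        - 3 * A₁ ^ 2 * A₂ * A₃ * X ^ 3 * w + 12 * A₁ ^ 2 * A₂ * A₃ * X ^ 2 * w * i
        + 6 * A₁ ^ 2 * A₂ * X ^ 3 - 6 * A₁ ^ 2 * A₂ * X ^ 2 * i
        + 3 * A₁ ^ 2 * A₃ ^ 2 * A₄ * X ^ 2 * w ^ 3 + 9 * A₁ ^ 2 * A₃ ^ 2 * A₆ * X * w ^ 4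
        - 9 * A₁ ^ 2 * A₃ ^ 2 * X ^ 4 * w - 15 * A₁ ^ 2 * A₃ * A₄ * X ^ 2 * w ^ 2
        - 18 * A₁ ^ 2 * A₃ * A₆ * X * w ^ 3 + 9 * A₁ ^ 2 * A₃ * X ^ 4
        + 12 * A₁ ^ 2 * A₄ * X ^ 2 * w + 9 * A₁ ^ 2 * A₆ * X * w ^ 2
        - 5 * A₁ * A₂ * A₃ ^ 3 * X ^ 2 * w ^ 3 - 4 * A₁ * A₂ * A₃ ^ 3 * X * w ^ 3 * i
        + 6 * A₁ * A₂ * A₃ ^ 2 * X ^ 2 * w ^ 2 + 12 * A₁ * A₂ * A₃ ^ 2 * X * w ^ 2 * i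
        + 3 * A₁ * A₂ * A₃ * X ^ 2 * w - 12 * A₁ * A₂ * A₃ * X * w * i - 4 * A₁ * A₂ * X ^ 2
        + 4 * A₁ * A₂ * X * i - A₁ * A₃ ^ 3 * A₄ * X * w ^ 4 + 3 * A₁ * A₃ ^ 3 * A₆ * w ^ 5
        - 9 * A₁ * A₃ ^ 3 * X ^ 3 * w ^ 2 - 6 * A₁ * A₃ ^ 2 * A₄ * X * w ^ 3
        - 9 * A₁ * A₃ ^ 2 * A₆ * w ^ 4 + 18 * A₁ * A₃ ^ 2 * X ^ 3 * w
        + 15 * A₁ * A₃ * A₄ * X * w ^ 2 + 9 * A₁ * A₃ * A₆ * w ^ 3 - 9 * A₁ * A₃ * X ^ 3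
        - 8 * A₁ * A₄ * X * w - 3 * A₁ * A₆ * w ^ 2 - 2 * A₂ * A₃ ^ 4 * X * w ^ 4
        - A₂ * A₃ ^ 4 * w ^ 4 * i + 5 * A₂ * A₃ ^ 3 * X * w ^ 3 + 4 * A₂ * A₃ ^ 3 * w ^ 3 * i
        - 3 * A₂ * A₃ ^ 2 * X * w ^ 2 - 6 * A₂ * A₃ ^ 2 * w ^ 2 * i - A₂ * A₃ * X * w
        + 4 * A₂ * A₃ * w * i + A₂ * X - A₂ * i - A₃ ^ 4 * A₄ * w ^ 5
        - 3 * A₃ ^ 4 * X ^ 2 * w ^ 3 + A₃ ^ 3 * A₄ * w ^ 4 + 9 * A₃ ^ 3 * X ^ 2 * w ^ 2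
        + 3 * A₃ ^ 2 * A₄ * w ^ 3 - 9 * A₃ ^ 2 * X ^ 2 * w - 5 * A₃ * A₄ * w ^ 2 + 3 * A₃ * X ^ 2
        + 2 * A₄ * w) * hiE +
      (3 * A₁ ^ 3 * A₃ * X ^ 3 + 9 * A₁ ^ 2 * A₃ ^ 2 * X ^ 2 * w - 9 * A₁ ^ 2 * A₃ * X ^ 2
        + 9 * A₁ * A₃ ^ 3 * X * w ^ 2 - 18 * A₁ * A₃ ^ 2 * X * w + 9 * A₁ * A₃ * X
        + 3 * A₃ ^ 4 * w ^ 3 - 9 * A₃ ^ 3 * w ^ 2 + 9 * A₃ ^ 2 * w - 3 * A₃) * hfp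
  -- cancel the unit `E⁵`
  rw [← e1, mul_assoc, ← pow_succ'] at e2
  have h0 : η * di + ηs = 0 := (hE.pow 5).mul_left_eq_zero.mp e2
  linear_combination h0

/-- **`D(h ∘ i) = -(Dh) ∘ i`**: the invariant derivation anticommutes with the formal inverse
(chain rule and `η · i' = -η(i)`). [Silverman AEC III.5.1] [folklore] -/
theorem formalInvariantDerivation_subst_formalNeg (h : R⟦X⟧) :
    W.formalInvariantDerivation (h.subst W.formalNeg) =
      -(W.formalInvariantDerivation h).subst W.formalNeg := by
  have hs := W.hasSubst_formalNeg
  rw [formalInvariantDerivation_apply, formalInvariantDerivation_apply,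
    PowerSeries.derivative_subst R hs, PowerSeries.subst_mul hs]
  linear_combination ((d⁄dX R h).subst W.formalNeg) * W.formalEta_mul_derivative_formalNeg

/-- **For an odd series, `Dσ` is even: `(Dσ)(i(z)) = (Dσ)(z)`** when `σ(i(z)) = -σ(z)`
(differentiate the oddness along `D` and use `D(σ ∘ i) = -(Dσ) ∘ i`). This is what makes the
first logarithmic derivatives in Blakestad–Grant's argument odd. [Blakestad–Grant 2023, Prop. 14
(proof: "the first logarithmic derivatives of both sides are odd in `t₁`")] [folklore] -/
theorem formalInvariantDerivation_subst_formalNeg_of_odd {σ : R⟦X⟧} (hodd : W.IsFormallyOdd σ) :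
    (W.formalInvariantDerivation σ).subst W.formalNeg = W.formalInvariantDerivation σ := by
  have h := W.formalInvariantDerivation_subst_formalNeg σ
  rw [show σ.subst W.formalNeg = -σ from hodd, map_neg, neg_inj] at h
  exact h.symm


end WeierstrassCurve
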